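import Summits.ResolutionOfSingularities.ResolutionOfSingularities.Theorems.WeightedInvariantContactCylinderGlobalMoveDictionary
import Summits.ResolutionOfSingularities.ResolutionOfSingularities.Theorems.WeightedInvariantHypersurfaceLocalGameEFT4SDimLETwoGame
import HarnessLib

/-!
# THE GLOBAL CYLINDER MOVE DROPS THE ORDER OVER THE GENERIC POINT OF THE CURVE ((W-η) of res-type-047's HCURVE step: the no-drop
# locus `W` misses `η`; door `HypersurfaceCentreConstruction`, stmt-ResolutionOfSingularities-19897; KEY `stub_localWeightedDropEFT4S`, P3a)

Topic: `Summits/ResolutionOfSingularities/ResolutionOfSingularities/Theorems`. Helper for the door item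
`HypersurfaceCentreConstruction` (stmt-ResolutionOfSingularities-19897, route `WeightedInvariant`), line `local-engine` of
res-L1-w43-plan-1 (L W4.3).  No new objects.  res-D-brk-1 NOTE (N1)/(N2) 2026-08-27T15:00:33Z: the generic drop for the cylinder /
global move is NOT the AQS lex-max theorem but the P2 GAME BODY `LocalGameEFTDimTwoGame.canonicalGameBody_of_not_isMonomialType` (K7:
`iotaOrd` drops at every successor of the TERMINAL contact move over the closed point of a two-dimensional regular local ring, off the
vertex).  This file re-keys that theorem on the FILTRATION `jContact S f` (any presentation `I` with `I m = jContact S f m` — the game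
body's own centre `(u, w)` presents the same pieces, so `extReesAlgebra I` IS its cobordant algebra, by substitution), reads the drop as
«the transform is NOT in `𝔪_𝔫^ν`» (`ν = ord f ≥ 2`; no `g/1 ∈ 𝔪_𝔫²` binder left), and transports it through the local/global dictionary
(p538779 (vii)′ + the consumer kit p542453) to the GLOBAL move over a prime `P′` of the base whose local ring is two-dimensional:
**every prime `𝔫` of `B = extReesAlgebra (weightedMonomialIdeal U W)` lying over `P′`, containing `t⁻¹` and missing a chart generator
`uᵢ t^{wᵢ}`, has `G/1 ∉ 𝔪_{B_𝔫}^ν`** for the global transform `f = t⁻ᵃ G`, `t⁻¹ ∤ G` — given that the localised pieces present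
`jContact (A′_{P′}) (f/1)` and are contracted from `A′_{P′}` (p544278 / uniform presentation).

[OURS · L1 W4.3 · (o28)/(D2)]  Replaces the role of NO printed item; NOT a statement of the manuscript
[claim: Hironaka2017, status: under-review]. AI work, weaker than expert review.  Pure commutative algebra; no named facts.

## References

* V. Cossart, U. Jannsen, S. Saito, *Desingularization: invariants and strategy*, LNM 2270, Ch. 8. [CossartJannsenSaito2020]
* res-type-005 / ORDER (o24-G) `canonicalGameBody_of_not_isMonomialType`; res-type-047 2026-08-27T14:50:40Z (HCURVE consumer).
-/

noncomputable section

open IsLocalRing Literature.AlgebraicGeometry.Resolution LaurentPolynomial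
open Summit.ResolutionOfSingularities.ResolutionOfSingularities.Cruxes.HypersurfaceCentreConstruction.LocalEngine

set_option linter.dupNamespace false -- mandated namespace of this single-conjunct summit

namespace Summit.ResolutionOfSingularities.ResolutionOfSingularities.Theorems

namespace ContactCylinder

/-! ## (1) The P2 game body keyed on the filtration `jContact S f` -/

/-- **The terminal contact move drops `iotaOrd` at every successor over the closed point, for ANY presentation `I` of the pieces
`jContact S f`** (`S` regular local of dimension two, essentially of finite type over a field, `0 ≠ f ∈ 𝔪²` not of monomial type):
for every prime `𝔫` of `extReesAlgebra I` with `t⁻¹ ∈ 𝔫`, `𝔪_S · extReesAlgebra I ≤ 𝔫`, `𝔫 ⊉ vertex`, and every `f = t⁻ᵃ g`, `t⁻¹ ∤ g`,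
`g/1 ∈ 𝔪_𝔫²`: `iotaOrd ((extReesAlgebra I)_𝔫) (g/1) < iotaOrd S f` (the game body `canonicalGameBody_of_not_isMonomialType`, whose own
centre presents the same pieces). [cite: CossartJannsenSaito2020, Ch. 8] -/
theorem iotaOrd_transform_lt_of_jContact_presentation (S : Type) [CommRing S] [IsRegularLocalRing S] (k₀ : Type) [Field k₀]
    [Algebra k₀ S] [Algebra.EssFiniteType k₀ S] (hdim : ringKrullDim S = 2) (f : S) (hf0 : f ≠ 0) (hf2 : f ∈ maximalIdeal S ^ 2)
    (hnm : ¬ IsMonomialType f) (I : ℕ → Ideal S) (hI : ∀ m, I m = jContact S f m)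
    (𝔫 : Ideal (extReesAlgebra I)) [𝔫.IsPrime] (hT : extReesAlgebra.tInv I ∈ 𝔫)
    (hM : (maximalIdeal S).map (algebraMap S (extReesAlgebra I)) ≤ 𝔫) (hV : ¬ extReesAlgebra.vertexIdeal I ≤ 𝔫)
    (a : ℕ) (g : extReesAlgebra I) (hfg : algebraMap S (extReesAlgebra I) f = extReesAlgebra.tInv I ^ a * g)
    (hTg : ¬ extReesAlgebra.tInv I ∣ g)
    (hg2 : algebraMap (extReesAlgebra I) (Localization.AtPrime 𝔫) g ∈ maximalIdeal (Localization.AtPrime 𝔫) ^ 2) :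
    iotaOrd (Localization.AtPrime 𝔫) (algebraMap (extReesAlgebra I) (Localization.AtPrime 𝔫) g) < iotaOrd S f := by
  obtain ⟨P, hP, -, -, -, -, n, u, w, -, -, -, -, hwm, -, hdrop⟩ :=
    LocalGameEFTDimTwoGame.canonicalGameBody_of_not_isMonomialType S k₀ hdim f hf0 hf2 (by unfold IsMonomialType at hnm; exact hnm)
  have hIeq : weightedMonomialIdeal u w = I := funext fun m => (hwm m).trans (hI m).symm
  subst hIeq
  haveI := hP
  exact hdrop 𝔫 hT ((Ideal.map_mono (IsLocalRing.le_maximalIdeal hP.ne_top)).trans hM) hV a g hfg hTg hg2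

/-- **Membership form, no `𝔪_𝔫²` binder**: under the same hypotheses, for every successor `𝔫` over the closed point off the vertex and
every `f = t⁻ᵃ g` with `t⁻¹ ∤ g`: **`g/1 ∉ 𝔪_𝔫^ν`**, `ν = ord f` (`≥ 2` since `f ∈ 𝔪²`; if `g/1 ∉ 𝔪_𝔫²` this is immediate, else the
game body drops `iotaOrd`). [cite: CossartJannsenSaito2020, Ch. 8] -/
theorem transform_not_mem_pow_of_jContact_presentation (S : Type) [CommRing S] [IsRegularLocalRing S] (k₀ : Type) [Field k₀]
    [Algebra k₀ S] [Algebra.EssFiniteType k₀ S] (hdim : ringKrullDim S = 2) (f : S) (hf0 : f ≠ 0) (hf2 : f ∈ maximalIdeal S ^ 2)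
    (hnm : ¬ IsMonomialType f) (I : ℕ → Ideal S) (hI : ∀ m, I m = jContact S f m)
    (𝔫 : Ideal (extReesAlgebra I)) [𝔫.IsPrime] (hT : extReesAlgebra.tInv I ∈ 𝔫)
    (hM : (maximalIdeal S).map (algebraMap S (extReesAlgebra I)) ≤ 𝔫) (hV : ¬ extReesAlgebra.vertexIdeal I ≤ 𝔫)
    (a : ℕ) (g : extReesAlgebra I) (hfg : algebraMap S (extReesAlgebra I) f = extReesAlgebra.tInv I ^ a * g)
    (hTg : ¬ extReesAlgebra.tInv I ∣ g) :
    algebraMap (extReesAlgebra I) (Localization.AtPrime 𝔫) g ∉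
      maximalIdeal (Localization.AtPrime 𝔫) ^ (adicOrder f).toNat := by
  -- `ν = ord f` is a natural number `≥ 2` and `iotaOrd S f = ν`
  obtain ⟨ν, hν⟩ : ∃ ν : ℕ, adicOrder f = ν := ENat.ne_top_iff_exists.mp (adicOrder_ne_top hf0) |>.imp fun _ h => h.symm
  have hν2 : 2 ≤ ν := by
    have h := (le_adicOrder_iff f 2).mpr hf2
    rw [hν] at h
    exact_mod_cast h
  have hιf : iotaOrd S f = ν := by
    rw [iotaOrd_eq_ordOfENat_adicOrder, hν, ordOfENat_natCast]
  rw [hν, ENat.toNat_coe]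
  intro hmem
  by_cases hg2 : algebraMap (extReesAlgebra I) (Localization.AtPrime 𝔫) g ∈ maximalIdeal (Localization.AtPrime 𝔫) ^ 2
  · have hlt := iotaOrd_transform_lt_of_jContact_presentation S k₀ hdim f hf0 hf2 hnm I hI 𝔫 hT hM hV a g hfg hTg hg2
    rw [hιf] at hlt
    exact (not_le.mpr hlt) ((natCast_le_iotaOrd_iff _ _ ν).mpr hmem)
  · exact hg2 (Ideal.pow_le_pow_right hν2 hmem)

/-! ## (2) Over the generic point of the curve: the global move -/

/-- **(W-η) THE NO-DROP LOCUS OF THE GLOBAL MOVE MISSES THE GENERIC POINT OF THE CURVE.**  `A′` a ring, `(U; W)` a weighted centre with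
global move `B = extReesAlgebra (weightedMonomialIdeal U W)`, `P′` a prime of `A′` whose local ring `S = A′_{P′}` is regular of dimension
two and essentially of finite type over a field; `f ∈ A′` with `f/1 ≠ 0`, `f/1 ∈ 𝔪_S²`, not of monomial type; suppose the localised pieces
`𝒥ₙ S` PRESENT `jContact S (f/1)` (uniform presentation at `η`) and are CONTRACTED from `S` (`(𝒥ₙ S) ∩ A′ = 𝒥ₙ`, p544278).  Then for the
global transform `f = t⁻ᵃ G` (`t⁻¹ ∤ G` in `B`), every prime `𝔫` of `B` lying over `P′` (`𝔫 ∩ A′ = P′`), containing `t⁻¹` and missing a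
chart generator `X = uᵢ t^{wᵢ}` (`wᵢ > 0`): **`G/1 ∉ 𝔪_{B_𝔫}^ν`**, `ν = ord_{S}(f/1)`.  (Dictionary (vii)′ at `𝔮 = P′`; `t⁻¹`-primitivity
transfers by contractedness; the vertex binder from `X ∉ 𝔫`; the local statement `transform_not_mem_pow_of_jContact_presentation`; order
transport along `g`.) [cite: CossartJannsenSaito2020, Ch. 8; Wlodarczyk2022, Def. 5.1.1] -/
theorem transform_not_mem_pow_of_over_generic_point {A' : Type} [CommRing A'] {m : ℕ} (U : Fin m → A') (W : Fin m → ℕ)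
    (P' : Ideal A') [P'.IsPrime] [IsRegularLocalRing (Localization.AtPrime P')] (k₀ : Type) [Field k₀]
    [Algebra k₀ (Localization.AtPrime P')] [Algebra.EssFiniteType k₀ (Localization.AtPrime P')]
    (hdim : ringKrullDim (Localization.AtPrime P') = 2) (f : A')
    (hf0 : algebraMap A' (Localization.AtPrime P') f ≠ 0)
    (hf2 : algebraMap A' (Localization.AtPrime P') f ∈ maximalIdeal (Localization.AtPrime P') ^ 2)
    (hnm : ¬ IsMonomialType (algebraMap A' (Localization.AtPrime P') f))
    (hJ : ∀ n, (weightedMonomialIdeal U W n).map (algebraMap A' (Localization.AtPrime P')) =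
      jContact (Localization.AtPrime P') (algebraMap A' (Localization.AtPrime P') f) n)
    (hcontr : ∀ n, ((weightedMonomialIdeal U W n).map (algebraMap A' (Localization.AtPrime P'))).comap
      (algebraMap A' (Localization.AtPrime P')) = weightedMonomialIdeal U W n)
    (𝔫 : Ideal (extReesAlgebra (weightedMonomialIdeal U W))) [𝔫.IsPrime]
    (h𝔫 : 𝔫.comap (algebraMap A' (extReesAlgebra (weightedMonomialIdeal U W))) = P')
    (hT : extReesAlgebra.tInv (weightedMonomialIdeal U W) ∈ 𝔫)
    {i : Fin m} (hi : 0 < W i) (X : extReesAlgebra (weightedMonomialIdeal U W)) (hX : (X : A'[T;T⁻¹]) = C (U i) * T (W i : ℤ))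
    (hXn : X ∉ 𝔫)
    (a : ℕ) (G : extReesAlgebra (weightedMonomialIdeal U W))
    (hfG : algebraMap A' (extReesAlgebra (weightedMonomialIdeal U W)) f = extReesAlgebra.tInv (weightedMonomialIdeal U W) ^ a * G)
    (hTG : ¬ extReesAlgebra.tInv (weightedMonomialIdeal U W) ∣ G) :
    algebraMap (extReesAlgebra (weightedMonomialIdeal U W)) (Localization.AtPrime 𝔫) G ∉
      maximalIdeal (Localization.AtPrime 𝔫) ^ (adicOrder (algebraMap A' (Localization.AtPrime P') f)).toNat := by
  -- the dictionary at `𝔮 = P′`, presentation `I' n = 𝒥ₙ S`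
  have hI' : ∀ n, (fun n => (weightedMonomialIdeal U W n).map (algebraMap A' (Localization.AtPrime P'))) n =
      (weightedMonomialIdeal U W n).map (algebraMap A' (Localization.AtPrime P')) := fun n => rfl
  have hd := disjoint_map_primeCompl_of_comap_eq P' 𝔫 h𝔫
  obtain ⟨ψ, 𝔫', h𝔫', g, hψc, hψa, hψt, hcomap, hg⟩ :=
    exists_ringHom_prime_ringEquiv_localMove' U W P' hI' 𝔫 hd
  -- the binders of the local statement at `𝔫'`
  have hT' : extReesAlgebra.tInv _ ∈ 𝔫' := by
    rw [← hψt]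
    exact (mem_iff_map_mem_of_comap_eq U W P' ψ hcomap _).mp hT
  have hM' : (maximalIdeal (Localization.AtPrime P')).map (algebraMap (Localization.AtPrime P') (extReesAlgebra _)) ≤ 𝔫' := by
    rw [← Localization.AtPrime.map_eq_maximalIdeal, ← map_algebraMap_le_iff_of_dictionary U W P' ψ hψa hcomap P',
      Ideal.map_le_iff_le_comap, h𝔫]
  have hV' := not_vertexIdeal_le_of_generator_not_mem U W P' hI' ψ hψc hcomap hi X hX hXn
  -- the transform through `ψ`: `(f/1) = t′ᵃ · ψ G`, `t′ ∤ ψ G` (contractedness)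
  have hfG' : algebraMap (Localization.AtPrime P') (extReesAlgebra _) (algebraMap A' (Localization.AtPrime P') f) =
      extReesAlgebra.tInv _ ^ a * ψ G := by
    rw [← hψa, hfG, map_mul, map_pow, hψt]
  have hTG' : ¬ extReesAlgebra.tInv _ ∣ ψ G := by
    refine not_tInv_dvd_map_of_forall U W P' hI' ψ hψc G hTG fun n hn => ?_
    have h := Ideal.mem_comap.mpr hn
    rwa [hcontr n] at h
  -- the local statement at `𝔫'`, transported along `g`
  intro hmem
  have hmem' := (mem_maximalIdeal_pow_iff_of_dictionary ψ 𝔫 𝔫' g hg G _).mp hmem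
  exact transform_not_mem_pow_of_jContact_presentation (Localization.AtPrime P') k₀ hdim _ hf0 hf2 hnm
    (fun n => (weightedMonomialIdeal U W n).map (algebraMap A' (Localization.AtPrime P'))) hJ 𝔫' hT' hM' hV' a (ψ G) hfG' hTG'
    hmem'

end ContactCylinder

end Summit.ResolutionOfSingularities.ResolutionOfSingularities.Theorems

end
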